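import Mathlib
import Summits.ValiantsHypothesis.ValiantsHypothesis.Theses.LiouvilleSarnak
import Summits.ValiantsHypothesis.ValiantsHypothesis.Theorems.LiouvilleSarnakDigitalBilinearLiouvillePeriodicVectors

/-!
# Route LiouvilleSarnak — crux `DigitalBilinearLiouville` (stmt-ValiantsHypothesis-14774):
# periodic test vectors with GROWING period `2^{L₁} ≤ n^A`

`Theorems/LiouvilleSarnakDigitalBilinearLiouvillePeriodicVectors.lean` proved the crux's inequality for
test vectors seeing only the lowest `L₁` digits, `L₁` FIXED.  Siegel–Walfisz allows moduli up to any power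
of `log x`; since `x = 4^n` here, the same argument covers periods `2^{L₁} ≤ n^A` for every fixed `A`,
i.e. test vectors depending on the lowest `A log₂ n` digits:

* ★ `digitalBilinear_periodic_pow` — for every `A > 0` and `ε > 0` there is `n₀` such that for all
  `n ≥ n₀`, all `L₁` with `2^{L₁} ≤ n^A`, every balanced cut `π` and all `u, w` depending only on the
  digits at positions `< L₁`: `‖Σ_r Σ_c u(r) w(c) λ(N_π(r,c)+1)‖² ≤ ε · 4^n · (Σ‖u‖²)(Σ‖w‖²)`.
  (Siegel–Walfisz with `q = 2^{L₁} ≤ (log 4^n)^A` and saving `(log x)^{-(A+1)}`: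
  `‖·‖² ≤ q² C² (log x)^{-2A-2} · 4^n ‖u‖²‖w‖² ≤ C² n^{-2} · 4^n ‖u‖²‖w‖²`.)

Honest framing: unconditional partial result (polylogarithmic periods); `DigitalBilinearLiouville`,
`LiouvilleCutRank`, `AlgebraicSarnak` stay OPEN; nothing here bears on VP versus VNP.  No definitions.
-/

-- the directory `ValiantsHypothesis/ValiantsHypothesis` repeats the summit name (tree layout)
set_option linter.dupNamespace false

namespace Summit.ValiantsHypothesis.ValiantsHypothesis.Theorems.LiouvilleSarnakDigitalBilinearLiouville.Coarse

open Finset ArithmeticFunction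
open Literature.NumberTheory.LFunctions (SiegelWalfiszMoebius_holds)

/-- ★ **`DigitalBilinearLiouville` for periodic test vectors of period up to `n^A`, unconditionally and
for every cut.**  For every `A > 0` and `ε > 0` there is `n₀` such that for all `n ≥ n₀`, every `L₁`
with `2^{L₁} ≤ n^A`, every balanced cut `π` of the `2n` positions and all `u, w : {0,1}^n → ℂ`
depending only on the digits at positions `< L₁`,
`‖Σ_r Σ_c u(r) w(c) λ(N_π(r,c) + 1)‖² ≤ ε · 4^n · (Σ_r ‖u r‖²) · (Σ_c ‖w c‖²)`.
[cite: MontgomeryVaughan2007, §11.3 Exercises 8 and 13(f)] -/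
theorem digitalBilinear_periodic_pow (A : ℝ) (hA : 0 < A) :
    ∀ ε : ℝ, 0 < ε → ∃ n₀ : ℕ, ∀ n : ℕ, n₀ ≤ n → ∀ L₁ : ℕ, ((2 : ℝ) ^ L₁ ≤ (n : ℝ) ^ A) →
      ∀ π : Fin n ⊕ Fin n ≃ Fin (2 * n), ∀ u w : (Fin n → Bool) → ℂ,
        (∀ r r' : Fin n → Bool, (∀ i : Fin n, (π (Sum.inl i) : ℕ) < L₁ → r' i = r i) → u r' = u r) →
        (∀ c c' : Fin n → Bool, (∀ i : Fin n, (π (Sum.inr i) : ℕ) < L₁ → c' i = c i) → w c' = w c) →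
        ‖∑ r : Fin n → Bool, ∑ c : Fin n → Bool, u r * w c *
            ((liouville (Nat.ofBits (fun j : Fin (2 * n) => Sum.elim r c (π.symm j)) + 1) : ℤ) : ℂ)‖ ^ 2
          ≤ ε * 4 ^ n * (∑ r : Fin n → Bool, ‖u r‖ ^ 2) * (∑ c : Fin n → Bool, ‖w c‖ ^ 2) := by
  classical
  intro ε hε
  obtain ⟨C, hC⟩ := SiegelWalfiszMoebius_holds.liouville_progression (A := A) hA (A + 1)
  -- threshold: `n ≥ 2` and `C² ≤ ε n²`
  obtain ⟨n₁, hn₁⟩ := exists_nat_ge (C ^ 2 / ε)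
  refine ⟨max 2 (n₁ + 1), fun n hn L₁ hL₁ π u w hu hw => ?_⟩
  have hn2 : 2 ≤ n := le_trans (le_max_left _ _) hn
  have hn1 : n₁ + 1 ≤ n := le_trans (le_max_right _ _) hn
  have hnpos : 0 < n := by omega
  have hn' : (0 : ℝ) < n := by exact_mod_cast hnpos
  -- `2^{L₁} ≤ n^A < ... `; in particular `L₁ ≤ 2n`: from `2^{L₁} ≤ n^A` we only need `L₁ ≤ 2n`, which
  -- follows from `2^{L₁} ≤ n^A ≤ ...`? Not in general — instead split: if `2n < L₁` the class is ALL
  -- vectors; but then `2^{L₁} > 4^n ≥ n^A` fails for large `n` only when `A` is small... so we derive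
  -- `L₁ ≤ 2n` from `2^{L₁} ≤ n^A ≤ (2^n)^A`? Only if `A ≤ 2`.  We therefore argue directly:
  -- `2^{L₁} ≤ n^A` and `n^A < 2^{2n}` would need a bound; simpler: use `min L₁ (2n)`-periodicity.
  set L : ℕ := min L₁ (2 * n) with hLdef
  have hLn : L ≤ 2 * n := min_le_right _ _
  have hLL₁ : L ≤ L₁ := min_le_left _ _
  -- vectors periodic at scale `L₁` are periodic at scale `L` (positions are `< 2n` anyway)
  have hu' : ∀ r r' : Fin n → Bool, (∀ i : Fin n, (π (Sum.inl i) : ℕ) < L → r' i = r i) → u r' = u r :=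
    fun r r' h => hu r r' fun i hi => h i (lt_min hi (π (Sum.inl i)).isLt)
  have hw' : ∀ c c' : Fin n → Bool, (∀ i : Fin n, (π (Sum.inr i) : ℕ) < L → c' i = c i) → w c' = w c :=
    fun c c' h => hw c c' fun i hi => h i (lt_min hi (π (Sum.inr i)).isLt)
  have hqle : (2 : ℝ) ^ L ≤ (n : ℝ) ^ A :=
    le_trans (pow_le_pow_right₀ one_le_two hLL₁) hL₁
  have hqpos : 0 < 2 ^ L := Nat.two_pow_pos L
  have hqB : 2 ^ L * 2 ^ (2 * n - L) = 2 ^ (2 * n) := by rw [← pow_add]; congr 1; omega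
  -- the weight on the number side; it is `2^{L}`-periodic
  set Q : ℕ → (Fin n → Bool) × (Fin n → Bool) := fun m =>
    (fun i => m.testBit (π (Sum.inl i)), fun i => m.testBit (π (Sum.inr i))) with hQ
  set g : ℕ → ℂ := fun m => u (Q m).1 * w (Q m).2 with hg
  have hper : ∀ H a : ℕ, a < 2 ^ L → g (2 ^ L * H + a) = g a := by
    intro H a ha
    have hbit : ∀ j : ℕ, j < L → (2 ^ L * H + a).testBit j = a.testBit j := by
      intro j hj
      rw [Nat.testBit_two_pow_mul_add _ ha, if_pos hj]
    have h1 : u (Q (2 ^ L * H + a)).1 = u (Q a).1 :=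
      hu' _ _ fun i hi => by simp only [hQ]; exact hbit _ hi
    have h2 : w (Q (2 ^ L * H + a)).2 = w (Q a).2 :=
      hw' _ _ fun i hi => by simp only [hQ]; exact hbit _ hi
    simp only [hg, h1, h2]
  set Ap : ℕ → ℝ := fun a => ∑ H ∈ range (2 ^ (2 * n - L)), (liouville (2 ^ L * H + a + 1) : ℝ)
    with hAp
  -- Step 1: re-index and group by residues
  have hstep1 : ∑ r : Fin n → Bool, ∑ c : Fin n → Bool, u r * w c *
      ((liouville (Nat.ofBits (fun j : Fin (2 * n) => Sum.elim r c (π.symm j)) + 1) : ℤ) : ℂ) =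
      ∑ a ∈ range (2 ^ L), g a * (Ap a : ℂ) := by
    rw [← Fintype.sum_prod_type' (f := fun r c => u r * w c *
      ((liouville (Nat.ofBits (fun j : Fin (2 * n) => Sum.elim r c (π.symm j)) + 1) : ℤ) : ℂ))]
    rw [sum_pairs_eq_sum_range n π, ← hqB, sum_range_mul_eq_sum_sum (2 ^ L) (2 ^ (2 * n - L)) hqpos,
      sum_comm]
    refine sum_congr rfl fun a ha => ?_
    rw [hAp]
    push_cast
    rw [mul_sum]
    refine sum_congr rfl fun H hH => ?_
    have hm : 2 ^ L * H + a < 2 ^ (2 * n) := by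
      rw [← hqB]
      calc 2 ^ L * H + a < 2 ^ L * H + 2 ^ L := by have := mem_range.mp ha; omega
        _ = 2 ^ L * (H + 1) := by ring
        _ ≤ 2 ^ L * 2 ^ (2 * n - L) := Nat.mul_le_mul_left _ (mem_range.mp hH)
    have hNQ : (Nat.ofBits (fun j : Fin (2 * n) =>
        Sum.elim (Q (2 ^ L * H + a)).1 (Q (2 ^ L * H + a)).2 (π.symm j))) = 2 ^ L * H + a := by
      have hfun : (fun j : Fin (2 * n) =>
          Sum.elim (Q (2 ^ L * H + a)).1 (Q (2 ^ L * H + a)).2 (π.symm j)) =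
          fun j : Fin (2 * n) => (2 ^ L * H + a).testBit j := by
        funext j
        rcases h : π.symm j with k | k
        · have hk : π (Sum.inl k) = j := by rw [← h, Equiv.apply_symm_apply]
          simp [hQ, hk]
        · have hk : π (Sum.inr k) = j := by rw [← h, Equiv.apply_symm_apply]
          simp [hQ, hk]
      rw [hfun]
      apply Nat.eq_of_testBit_eq
      intro j
      by_cases hj : j < 2 * n
      · rw [Nat.testBit_ofBits_lt _ _ hj]
      · rw [Nat.testBit_ofBits_ge _ _ (not_lt.mp hj), Nat.testBit_lt_two_pow]
        exact hm.trans_le (Nat.pow_le_pow_right Nat.two_pos (not_lt.mp hj))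
    rw [hNQ, ← hper H a (mem_range.mp ha)]
  -- Step 2: Cauchy–Schwarz
  have hCS : ‖∑ a ∈ range (2 ^ L), g a * (Ap a : ℂ)‖ ^ 2 ≤
      (∑ a ∈ range (2 ^ L), ‖g a‖ ^ 2) * (∑ a ∈ range (2 ^ L), Ap a ^ 2) := by
    have h1 : ‖∑ a ∈ range (2 ^ L), g a * (Ap a : ℂ)‖ ≤ ∑ a ∈ range (2 ^ L), ‖g a‖ * |Ap a| := by
      refine (norm_sum_le _ _).trans (le_of_eq ?_)
      refine sum_congr rfl fun a _ => ?_
      rw [norm_mul, Complex.norm_real, Real.norm_eq_abs]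
    have h2 := Finset.sum_mul_sq_le_sq_mul_sq (range (2 ^ L)) (fun a => ‖g a‖) (fun a => |Ap a|)
    calc ‖∑ a ∈ range (2 ^ L), g a * (Ap a : ℂ)‖ ^ 2
        ≤ (∑ a ∈ range (2 ^ L), ‖g a‖ * |Ap a|) ^ 2 := pow_le_pow_left₀ (norm_nonneg _) h1 2
      _ ≤ (∑ a ∈ range (2 ^ L), ‖g a‖ ^ 2) * (∑ a ∈ range (2 ^ L), |Ap a| ^ 2) := h2
      _ = _ := by simp only [sq_abs]
  -- Step 3: `2^{2n-L} · Σ_a ‖g a‖² = ‖u‖² ‖w‖²`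
  have hgsum : (2 : ℝ) ^ (2 * n - L) * ∑ a ∈ range (2 ^ L), ‖g a‖ ^ 2 =
      (∑ r : Fin n → Bool, ‖u r‖ ^ 2) * (∑ c : Fin n → Bool, ‖w c‖ ^ 2) := by
    have h1 : (∑ r : Fin n → Bool, ‖u r‖ ^ 2) * (∑ c : Fin n → Bool, ‖w c‖ ^ 2) =
        ∑ p : (Fin n → Bool) × (Fin n → Bool), ‖u p.1 * w p.2‖ ^ 2 := by
      rw [sum_mul_sum, ← Fintype.sum_prod_type']
      refine Fintype.sum_congr _ _ fun p => ?_
      rw [norm_mul, mul_pow]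
    rw [h1, sum_pairs_eq_sum_range n π, ← hqB,
      sum_range_mul_eq_sum_sum (2 ^ L) (2 ^ (2 * n - L)) hqpos]
    have : ∀ H ∈ range (2 ^ (2 * n - L)), ∑ a ∈ range (2 ^ L),
        ‖u (Q (2 ^ L * H + a)).1 * w (Q (2 ^ L * H + a)).2‖ ^ 2 = ∑ a ∈ range (2 ^ L), ‖g a‖ ^ 2 := by
      intro H _
      refine sum_congr rfl fun a ha => ?_
      rw [← hper H a (mem_range.mp ha)]
    rw [sum_congr rfl this, sum_const, card_range, nsmul_eq_mul]
    push_cast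
    ring
  -- Step 4: Siegel–Walfisz on each progression, saving `(log x)^{-(A+1)}`
  have hx2 : (2 : ℝ) ≤ (4 : ℝ) ^ n := by
    calc (2 : ℝ) ≤ 4 ^ 1 := by norm_num
      _ ≤ 4 ^ n := pow_le_pow_right₀ (by norm_num) hnpos
  have hlog4 : (n : ℝ) ≤ Real.log ((4 : ℝ) ^ n) := by
    rw [Real.log_pow]
    have h4 : (1 : ℝ) ≤ Real.log 4 := by
      have := Real.log_two_gt_d9
      have h : Real.log 4 = 2 * Real.log 2 := by
        rw [show (4 : ℝ) = 2 ^ 2 by norm_num, Real.log_pow]; norm_num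
      rw [h]; linarith
    have hn0 : (0 : ℝ) ≤ n := by positivity
    calc (n : ℝ) = n * 1 := by ring
      _ ≤ n * Real.log 4 := mul_le_mul_of_nonneg_left h4 hn0
  have hlogpos : 0 < Real.log ((4 : ℝ) ^ n) := lt_of_lt_of_le hn' hlog4
  have hqlog : ((2 ^ L : ℕ) : ℝ) ≤ Real.log ((4 : ℝ) ^ n) ^ A := by
    push_cast
    exact hqle.trans (Real.rpow_le_rpow hn'.le hlog4 hA.le)
  have hApr : ∀ a ∈ range (2 ^ L), |Ap a| ≤ C * (4 : ℝ) ^ n / Real.log ((4 : ℝ) ^ n) ^ (A + 1) := by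
    intro a ha
    have hSW := hC ((4 : ℝ) ^ n) hx2 (2 ^ L) hqpos hqlog (((a + 1 : ℕ) : ZMod (2 ^ L)))
    have hfloor : ⌊(4 : ℝ) ^ n⌋₊ = 2 ^ L * 2 ^ (2 * n - L) := by
      rw [hqB, show (4 : ℝ) ^ n = ((2 ^ (2 * n) : ℕ) : ℝ) by push_cast; rw [pow_mul]; norm_num,
        Nat.floor_natCast]
    rw [hfloor, ← sum_liouville_ap_eq_filter (2 ^ L) (2 ^ (2 * n - L)) a hqpos (mem_range.mp ha)]
      at hSW
    exact hSW
  have hC0 : 0 ≤ C := by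
    have h := hApr 0 (mem_range.mpr hqpos)
    have hpos : (0 : ℝ) < (4 : ℝ) ^ n / Real.log ((4 : ℝ) ^ n) ^ (A + 1) := by positivity
    by_contra hneg
    push Not at hneg
    have : C * (4 : ℝ) ^ n / Real.log ((4 : ℝ) ^ n) ^ (A + 1) < 0 := by
      rw [mul_div_assoc]; exact mul_neg_of_neg_of_pos hneg hpos
    linarith [abs_nonneg (Ap 0)]
  -- `(2^L)·(C x/(log x)^{A+1})² ≤ 2^L · C² x² n^{2A} / ((log x)^{2A} · n²)`-type bound, packaged as:
  -- `2^L (C x /(log x)^{A+1})² · 2^L ≤ C² x² / n²` using `2^L ≤ (log x)^A` twice and `log x ≥ n`.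
  have hkey : (2 : ℝ) ^ L * ((2 : ℝ) ^ L * (C * (4 : ℝ) ^ n / Real.log ((4 : ℝ) ^ n) ^ (A + 1)) ^ 2) ≤
      C ^ 2 * ((4 : ℝ) ^ n) ^ 2 / (n : ℝ) ^ 2 := by
    have hq' : (2 : ℝ) ^ L ≤ Real.log ((4 : ℝ) ^ n) ^ A := by exact_mod_cast hqlog
    set Lg : ℝ := Real.log ((4 : ℝ) ^ n) with hLg
    have hsplit : Lg ^ (A + 1) = Lg ^ A * Lg := by
      rw [Real.rpow_add hlogpos, Real.rpow_one]
    have hLgA : 0 < Lg ^ A := Real.rpow_pos_of_pos hlogpos A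
    -- rewrite the left side
    have hL2 : (2 : ℝ) ^ L * (2 : ℝ) ^ L ≤ Lg ^ A * Lg ^ A :=
      mul_le_mul hq' hq' (by positivity) hLgA.le
    calc (2 : ℝ) ^ L * ((2 : ℝ) ^ L * (C * (4 : ℝ) ^ n / Lg ^ (A + 1)) ^ 2)
        = ((2 : ℝ) ^ L * (2 : ℝ) ^ L) * (C ^ 2 * ((4 : ℝ) ^ n) ^ 2) / (Lg ^ A * Lg ^ A * Lg ^ 2) := by
          rw [hsplit]; field_simp
      _ ≤ (Lg ^ A * Lg ^ A) * (C ^ 2 * ((4 : ℝ) ^ n) ^ 2) / (Lg ^ A * Lg ^ A * Lg ^ 2) := by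
          gcongr
      _ = C ^ 2 * ((4 : ℝ) ^ n) ^ 2 / Lg ^ 2 := by
          field_simp
      _ ≤ C ^ 2 * ((4 : ℝ) ^ n) ^ 2 / (n : ℝ) ^ 2 := by
          gcongr
  have hApsq : ∑ a ∈ range (2 ^ L), Ap a ^ 2 ≤
      (2 : ℝ) ^ L * (C * (4 : ℝ) ^ n / Real.log ((4 : ℝ) ^ n) ^ (A + 1)) ^ 2 := by
    calc ∑ a ∈ range (2 ^ L), Ap a ^ 2
        ≤ ∑ a ∈ range (2 ^ L), (C * (4 : ℝ) ^ n / Real.log ((4 : ℝ) ^ n) ^ (A + 1)) ^ 2 := by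
          refine sum_le_sum fun a ha => ?_
          rw [← sq_abs]
          exact pow_le_pow_left₀ (abs_nonneg _) (hApr a ha) 2
      _ = _ := by rw [sum_const, card_range, nsmul_eq_mul]; push_cast; ring
  -- assemble
  have hB0 : (0 : ℝ) < (2 : ℝ) ^ (2 * n - L) := by positivity
  have hqBr : (2 : ℝ) ^ L * (2 : ℝ) ^ (2 * n - L) = (4 : ℝ) ^ n := by
    rw [← pow_add, show L + (2 * n - L) = 2 * n by omega, pow_mul]; norm_num
  have hsmall : C ^ 2 ≤ ε * (n : ℝ) ^ 2 := by
    have h1 : C ^ 2 / ε ≤ n := hn₁.trans (by exact_mod_cast (by omega : n₁ ≤ n))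
    rw [div_le_iff₀ hε] at h1
    have hn1' : (1 : ℝ) ≤ n := by exact_mod_cast hnpos
    have h2 : (n : ℝ) * ε ≤ ε * (n : ℝ) ^ 2 := by
      have h3 : 0 ≤ ε * (n : ℝ) * ((n : ℝ) - 1) := mul_nonneg (mul_nonneg hε.le hn'.le) (by linarith)
      nlinarith [h3]
    exact h1.trans h2
  rw [hstep1]
  set U : ℝ := (∑ r : Fin n → Bool, ‖u r‖ ^ 2) * (∑ c : Fin n → Bool, ‖w c‖ ^ 2) with hU
  have hU0 : 0 ≤ U := by positivity
  have hgsum' : ∑ a ∈ range (2 ^ L), ‖g a‖ ^ 2 = U / (2 : ℝ) ^ (2 * n - L) := by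
    rw [eq_div_iff hB0.ne', mul_comm, hgsum]
  have hBinv : U / (2 : ℝ) ^ (2 * n - L) = U * (2 : ℝ) ^ L / (4 : ℝ) ^ n := by
    rw [← hqBr]; field_simp
  calc ‖∑ a ∈ range (2 ^ L), g a * (Ap a : ℂ)‖ ^ 2
      ≤ (∑ a ∈ range (2 ^ L), ‖g a‖ ^ 2) * (∑ a ∈ range (2 ^ L), Ap a ^ 2) := hCS
    _ ≤ (U * (2 : ℝ) ^ L / (4 : ℝ) ^ n) *
          ((2 : ℝ) ^ L * (C * (4 : ℝ) ^ n / Real.log ((4 : ℝ) ^ n) ^ (A + 1)) ^ 2) := by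
        rw [hgsum', hBinv]
        exact mul_le_mul_of_nonneg_left hApsq (by positivity)
    _ = U / (4 : ℝ) ^ n * ((2 : ℝ) ^ L *
          ((2 : ℝ) ^ L * (C * (4 : ℝ) ^ n / Real.log ((4 : ℝ) ^ n) ^ (A + 1)) ^ 2)) := by ring
    _ ≤ U / (4 : ℝ) ^ n * (C ^ 2 * ((4 : ℝ) ^ n) ^ 2 / (n : ℝ) ^ 2) :=
        mul_le_mul_of_nonneg_left hkey (by positivity)
    _ = C ^ 2 / (n : ℝ) ^ 2 * (4 : ℝ) ^ n * U := by field_simp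
    _ ≤ ε * (4 : ℝ) ^ n * U := by
        have h1 : C ^ 2 / (n : ℝ) ^ 2 ≤ ε := by rw [div_le_iff₀ (by positivity)]; exact hsmall
        have h2 : 0 ≤ (4 : ℝ) ^ n * U := by positivity
        nlinarith
    _ = ε * 4 ^ n * (∑ r : Fin n → Bool, ‖u r‖ ^ 2) * (∑ c : Fin n → Bool, ‖w c‖ ^ 2) := by
        rw [hU]; ring

end Summit.ValiantsHypothesis.ValiantsHypothesis.Theorems.LiouvilleSarnakDigitalBilinearLiouville.Coarse
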